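import Literature.Probability.RandomPlanarGeometry.PlanarBrownianAnnulus
import HarnessLib

/-!
# Planar Brownian motion: after hitting a disc, avoiding a concentric smaller disc is unlikely

Proof file (theorems only), continuing `PlanarBrownianAnnulus`. For the planar Brownian motion
`Z` (`BrownianLoop.planarBrownian` on `(WienerPair, wienerPair)`) started at `w`, radii
`0 < r₁ < a < ρ`, a deadline `t₁` and a window `θ > 0`:

* `measure_hit_then_avoid_le` — **the probability that `w + Z` visits `B̄(c, a)` by time `t₁` AND
  avoids `B̄(c, r₁)` up to time `T ≥ t₁ + θ` is at most
  `(log(a/r₁)/log(ρ/r₁) + ρ²/(2θ)) · P(w + Z visits B̄(c, a) by time t₁)`.**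

This is the "second logarithm" of the finiteness of Brownian loop masses: a loop coming `ε`-close
to a point while avoiding an `ε`-disc around it must, right after the hitting time `τ` of
`B̄(c, a)`, either leave `B(c, ρ)` before touching `B̄(c, r₁)` — probability `≤ log(a/r₁)/log(ρ/r₁)`
by optional stopping of the harmonic function `log |X − c|` between `τ` and the exit time of the
annulus (`IsBrownianVec.setIntegral_stopped_sub_of_confined` with the logarithmic potential,
`Process/PlanarPotentials`) — or stay inside `B(c, ρ)` during `[τ, τ + θ]` — probability
`≤ ρ²/(2θ)` by the same identity for `|X − c|²` (Laplacian `4`), which says that the expected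
time spent in `B̄(c, ρ)` after `τ` is at most `ρ²/2`. Both conditional bounds are relative to the
event `{τ ≤ t₁} ∈ 𝓕_τ`, which is where the two-stopping-time form of optional stopping is needed.
No definition and no named fact is introduced.

## References

* J.-F. Le Gall, *Brownian Motion, Martingales, and Stochastic Calculus*, GTM 274 (2016), Ch. 7,
  Prop. 7.16 / Thm. 7.17 (proofs, planar case) and Ch. 3 Cor. 3.23. [Legall2016]
-/

noncomputable section

open MeasureTheory ProbabilityTheory Filter Set Metric Complex
open scoped NNReal ENNReal Topology

namespace Literature.Probability.RandomPlanarGeometry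

open Literature.Probability.Process
open BrownianLoop (planarBrownian)

/-- A continuous path which lies in a closed set on `[a, b)` (`a < b`) lies in it at `b`. [folklore] -/
theorem mem_of_forall_mem_Ico {E : Type*} [TopologicalSpace E] {p : ℝ≥0 → E} (hp : Continuous p)
    {K : Set E} (hK : IsClosed K) {a b : ℝ≥0} (hab : a < b) (h : ∀ r, a ≤ r → r < b → p r ∈ K) :
    p b ∈ K := by
  have hS : IsClosed {r : ℝ≥0 | p r ∈ K} := hK.preimage hp
  have hsub : Ico a b ⊆ {r : ℝ≥0 | p r ∈ K} := fun r hr ↦ h r hr.1 hr.2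
  have hcl : closure (Ico a b) ⊆ {r : ℝ≥0 | p r ∈ K} := closure_minimal hsub hS
  apply hcl
  rw [closure_Ico hab.ne]
  exact right_mem_Icc.2 hab.le

/-- A finite extended time is the coercion of its `untopA` (same statement as the lemma of the
same unprimed name in `SLESlopeOccupation`, which this light file does not import). [folklore] -/
theorem coe_untopA_of_ne_top' {x : WithTop ℝ≥0} (h : x ≠ ⊤) : ((x.untopA : ℝ≥0) : WithTop ℝ≥0) = x := by
  rw [WithTop.untopA_eq_untop h, WithTop.coe_untop]

/-- **Hitting a disc and then avoiding a smaller concentric disc.** Let `0 < r₁ < a < ρ`, `θ > 0`,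
`t₁ ≥ 0` and `T ≥ t₁ + θ`. Then for every starting point `w`,

  `P( (∃ s ≤ t₁, w + Z_s ∈ B̄(c, a)) ∧ ∀ s ≤ T, w + Z_s ∉ B̄(c, r₁) )`
    `≤ (log(a/r₁)/log(ρ/r₁) + ρ²/(2θ)) · P(∃ s ≤ t₁, w + Z_s ∈ B̄(c, a))`.

[cite: Legall2016, Ch. 7 Prop. 7.16 / Thm. 7.17 (proofs, planar case)] -/
theorem measure_hit_then_avoid_le {c : ℂ} (w : ℂ) {r₁ a ρ : ℝ} {θ t₁ T : ℝ≥0} (hr₁ : 0 < r₁)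
    (hra : r₁ < a) (haρ : a < ρ) (hθ : 0 < θ) (hT : t₁ + θ ≤ T) :
    wienerPair {ω | (∃ s ≤ t₁, w + planarBrownian s ω ∈ closedBall c a) ∧
        ∀ s ≤ T, w + planarBrownian s ω ∉ closedBall c r₁} ≤
      ENNReal.ofReal (Real.log (a / r₁) / Real.log (ρ / r₁) + ρ ^ 2 / (2 * θ)) *
        wienerPair {ω | ∃ s ≤ t₁, w + planarBrownian s ω ∈ closedBall c a} := by
  have ha : 0 < a := hr₁.trans hra
  have hρ : 0 < ρ := ha.trans haρ
  -- trivial case: the starting point is already in the small disc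
  by_cases hw : ‖w - c‖ ≤ r₁
  · have hempty : {ω : WienerPair | (∃ s ≤ t₁, w + planarBrownian s ω ∈ closedBall c a) ∧
        ∀ s ≤ T, w + planarBrownian s ω ∉ closedBall c r₁} = ∅ := by
      ext ω
      simp only [mem_setOf_eq, mem_empty_iff_false, iff_false, not_and]
      intro _ h
      exact h 0 bot_le (by simpa [BrownianLoop.planarBrownian_zero, mem_closedBall, dist_eq_norm] using hw)
    rw [hempty, measure_empty]
    exact bot_le
  push Not at hw
  -- the vector model
  set W : ℝ≥0 → WienerPair → (Fin 2 → ℝ) := fun t ω ↦ ![brownian t ω.1, brownian t ω.2] with hWdef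
  have hW : IsBrownianVec W wienerPair := isBrownianVec_planar
  set x₀ : Fin 2 → ℝ := ![w.re, w.im] with hx₀
  set N : (Fin 2 → ℝ) → ℝ := fun v ↦ ‖(v 0 : ℂ) + (v 1 : ℂ) * I - c‖ with hNdef
  have hNcont : Continuous N := (continuous_toC.sub continuous_const).norm
  have hNX : ∀ s ω, N (x₀ + W s ω) = ‖w + planarBrownian s ω - c‖ := fun s ω ↦ by
    simp only [hNdef, hx₀, hWdef]
    rw [toC_start_add_planar]
  have hNx₀ : N x₀ = ‖w - c‖ := by simp only [hNdef, hx₀]; rw [toC_reIm]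
  have hXcont : ∀ ω, Continuous fun r ↦ x₀ + W r ω := fun ω ↦ continuous_const.add (hW.continuous_path ω)
  have hadapt : Adapted hW.natFiltration fun r ω ↦ x₀ + W r ω := fun r ↦
    measurable_const.add (hW.measurable_apply_le le_rfl)
  -- the closed sets
  set A₁ : Set (Fin 2 → ℝ) := {v | N v ≤ a} with hA₁
  have hA₁c : IsClosed A₁ := isClosed_le hNcont continuous_const
  set Fout : Set (Fin 2 → ℝ) := {v | ρ ≤ N v} with hFout
  have hFoutc : IsClosed Fout := isClosed_le continuous_const hNcont
  set Fo : Set (Fin 2 → ℝ) := {v | N v ≤ r₁} ∪ Fout with hFo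
  have hFoc : IsClosed Fo := (isClosed_le hNcont continuous_const).union hFoutc
  set Kann : Set (Fin 2 → ℝ) := {v | r₁ ≤ N v ∧ N v ≤ ρ} with hKann
  have hKannc : IsCompact Kann := by
    refine Metric.isCompact_of_isClosed_isBounded
      ((isClosed_le continuous_const hNcont).inter (isClosed_le hNcont continuous_const)) ?_
    refine isBounded_of_norm_toC_le (R := ‖c‖ + ρ) fun v hv ↦ ?_
    have h1 : ‖(v 0 : ℂ) + (v 1 : ℂ) * I‖ ≤ ‖(v 0 : ℂ) + (v 1 : ℂ) * I - c‖ + ‖c‖ := norm_le_norm_sub_add _ _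
    have h2 : N v ≤ ρ := hv.2
    simp only [hNdef] at h2
    linarith
  set Kball : Set (Fin 2 → ℝ) := {v | N v ≤ ρ} with hKball
  have hKballc : IsCompact Kball := by
    refine Metric.isCompact_of_isClosed_isBounded (isClosed_le hNcont continuous_const) ?_
    refine isBounded_of_norm_toC_le (R := ‖c‖ + ρ) fun v hv ↦ ?_
    have h1 : ‖(v 0 : ℂ) + (v 1 : ℂ) * I‖ ≤ ‖(v 0 : ℂ) + (v 1 : ℂ) * I - c‖ + ‖c‖ := norm_le_norm_sub_add _ _
    have h2 : N v ≤ ρ := hv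
    simp only [hNdef] at h2
    linarith
  -- the stopping times
  set τ := IsBrownianVec.hitTime x₀ W A₁ with hτdef
  have hτ : IsStoppingTime hW.natFiltration τ := hW.isStoppingTime_hitTime hA₁c
  set σ := hittingFrom (fun r ω ↦ x₀ + W r ω) Fo τ with hσdef
  have hσ : IsStoppingTime hW.natFiltration σ := isStoppingTime_hittingFrom hadapt hXcont hFoc hτ
  have hτσ : τ ≤ σ := fun ω ↦ le_hittingFrom
  set σ₂ := hittingFrom (fun r ω ↦ x₀ + W r ω) Fout τ with hσ₂def
  have hσ₂ : IsStoppingTime hW.natFiltration σ₂ := isStoppingTime_hittingFrom hadapt hXcont hFoutc hτ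
  have hτσ₂ : τ ≤ σ₂ := fun ω ↦ le_hittingFrom
  have hσσ₂ : σ ≤ σ₂ := by
    intro ω
    induction h2 : σ₂ ω with
    | top => exact le_top
    | coe s₂ =>
      have hmem : x₀ + W s₂ ω ∈ Fout := mem_of_hittingFrom_eq_coe hFoutc (hXcont ω) h2
      have hτs : τ ω ≤ s₂ := by
        have h3 : τ ω ≤ σ₂ ω := le_hittingFrom
        rwa [h2] at h3
      exact hittingFrom_le_of_mem hτs (Or.inr hmem)
  -- the event `A = {τ ≤ t₁}` and its description
  set A : Set WienerPair := {ω | τ ω ≤ t₁} with hAdef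
  have hA : MeasurableSet[hτ.measurableSpace] A := hτ.measurableSet_le' t₁
  have hAm : MeasurableSet A := hτ.measurableSpace_le _ hA
  have hAeq : A = {ω | ∃ s ≤ t₁, w + planarBrownian s ω ∈ closedBall c a} := by
    ext ω
    simp only [hAdef, mem_setOf_eq, hτdef]
    rw [hW.hitTime_le_coe_iff hA₁c]
    refine exists_congr fun s ↦ and_congr_right fun _ ↦ ?_
    simp only [hA₁, mem_setOf_eq, hNX, mem_closedBall, dist_eq_norm]
  -- at the hitting time the path is in the annulus `r₁ < N ≤ a`
  have hXτ : ∀ ω (τ₀ : ℝ≥0), τ ω = τ₀ → r₁ < N (x₀ + W τ₀ ω) ∧ N (x₀ + W τ₀ ω) ≤ a := by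
    intro ω τ₀ hτ₀
    have hmem : x₀ + W τ₀ ω ∈ A₁ := hW.mem_of_hitTime_eq_coe hA₁c hτ₀
    refine ⟨?_, hmem⟩
    by_cases hwa : N x₀ ≤ a
    · -- started inside `B̄(c, a)`: `τ = 0`
      have h0 : τ ω ≤ (0 : ℝ≥0) := IsBrownianVec.hitTime_le_of_mem (by
        show x₀ + W 0 ω ∈ A₁
        rw [hW.apply_zero, add_zero]; exact hwa)
      have hτ00 : τ₀ = 0 := by
        rw [hτ₀] at h0
        exact le_antisymm (WithTop.coe_le_coe.1 h0) bot_le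
      rw [hτ00, hW.apply_zero, add_zero, hNx₀]
      exact hw
    · -- started outside: the hitting point is in the closure of the complement
      have hx₀A : x₀ ∉ A₁ := hwa
      have hcl : x₀ + W τ₀ ω ∈ closure A₁ᶜ := by
        have := hW.mem_closure_compl_of_le hA₁c hx₀A τ₀ ω
          (r := (min (τ₀ : WithTop ℝ≥0) (τ ω)).untopA) le_rfl
        rwa [hτ₀, untopA_min_coe_coe, min_self] at this
      have hcl' : closure A₁ᶜ ⊆ {v | a ≤ N v} := by
        refine closure_minimal (fun v hv ↦ ?_) (isClosed_le continuous_const hNcont)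
        have hv' : ¬ N v ≤ a := hv
        exact (not_le.1 hv').le
      exact lt_of_lt_of_le hra (hcl' hcl)
  -- the deterministic horizon `t = t₁ + θ`
  set t : ℝ≥0 := t₁ + θ with htdef
  -- on `A`, `t ∧ τ = τ`
  have hminτ : ∀ ω ∈ A, ∀ τ₀ : ℝ≥0, τ ω = τ₀ → (min (t : WithTop ℝ≥0) (τ ω)).untopA = τ₀ := by
    intro ω hω τ₀ hτ₀
    have hle : τ₀ ≤ t := by
      have : (τ₀ : WithTop ℝ≥0) ≤ t₁ := by rw [← hτ₀]; exact hω
      exact (WithTop.coe_le_coe.1 this).trans (le_self_add)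
    rw [hτ₀, untopA_min_coe_coe, min_eq_right hle]
  have hAfin : ∀ ω ∈ A, ∃ τ₀ : ℝ≥0, τ ω = τ₀ := fun ω hω ↦
    WithTop.ne_top_iff_exists.1 (ne_top_of_le_ne_top WithTop.coe_ne_top hω) |>.imp fun _ h ↦ h.symm
  -- confinement between `τ` and `σ` in the annulus `Kann`
  have hconf1 : ∀ ω ∈ A, ∀ r : ℝ≥0, (min (t : WithTop ℝ≥0) (τ ω)).untopA ≤ r →
      r ≤ (min (t : WithTop ℝ≥0) (σ ω)).untopA → x₀ + W r ω ∈ Kann := by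
    intro ω hω r hr1 hr2
    obtain ⟨τ₀, hτ₀⟩ := hAfin ω hω
    rw [hminτ ω hω τ₀ hτ₀] at hr1
    have hτr : τ ω ≤ r := by rw [hτ₀]; exact WithTop.coe_le_coe.2 hr1
    by_cases hlt : (r : WithTop ℝ≥0) < σ ω
    · have hnot : x₀ + W r ω ∉ Fo := notMem_of_lt_hittingFrom hτr hlt
      simp only [hFo, hFout, mem_union, mem_setOf_eq, not_or, not_le] at hnot
      exact ⟨hnot.1.le, hnot.2.le⟩
    · -- `σ ω = r`
      have hσr : σ ω = r := by
        refine le_antisymm (not_lt.1 hlt) ?_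
        have h1 : (r : WithTop ℝ≥0) ≤ min (t : WithTop ℝ≥0) (σ ω) := by
          have hne : min (t : WithTop ℝ≥0) (σ ω) ≠ ⊤ := ne_top_of_le_ne_top WithTop.coe_ne_top (min_le_left _ _)
          rw [← coe_untopA_of_ne_top' hne]; exact WithTop.coe_le_coe.2 hr2
        exact h1.trans (min_le_right _ _)
      rcases eq_or_lt_of_le hr1 with h | h
      · rw [← h]
        have := hXτ ω τ₀ hτ₀
        exact ⟨this.1.le, this.2.trans haρ.le⟩
      · refine mem_of_forall_mem_Ico (hXcont ω) hKannc.isClosed h fun r' h1 h2 ↦ ?_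
        have hτr' : τ ω ≤ r' := by rw [hτ₀]; exact WithTop.coe_le_coe.2 h1
        have hlt' : (r' : WithTop ℝ≥0) < σ ω := by rw [hσr]; exact WithTop.coe_lt_coe.2 h2
        have hnot : x₀ + W r' ω ∉ Fo := notMem_of_lt_hittingFrom hτr' hlt'
        simp only [hFo, hFout, mem_union, mem_setOf_eq, not_or, not_le] at hnot
        exact ⟨hnot.1.le, hnot.2.le⟩
  -- confinement between `τ` and `σ₂` in the ball `Kball`
  have hconf2 : ∀ ω ∈ A, ∀ r : ℝ≥0, (min (t : WithTop ℝ≥0) (τ ω)).untopA ≤ r →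
      r ≤ (min (t : WithTop ℝ≥0) (σ₂ ω)).untopA → x₀ + W r ω ∈ Kball := by
    intro ω hω r hr1 hr2
    obtain ⟨τ₀, hτ₀⟩ := hAfin ω hω
    rw [hminτ ω hω τ₀ hτ₀] at hr1
    have hτr : τ ω ≤ r := by rw [hτ₀]; exact WithTop.coe_le_coe.2 hr1
    by_cases hlt : (r : WithTop ℝ≥0) < σ₂ ω
    · have hnot : ¬ ρ ≤ N (x₀ + W r ω) := notMem_of_lt_hittingFrom hτr hlt
      exact (not_le.1 hnot).le
    · have hσr : σ₂ ω = r := by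
        refine le_antisymm (not_lt.1 hlt) ?_
        have h1 : (r : WithTop ℝ≥0) ≤ min (t : WithTop ℝ≥0) (σ₂ ω) := by
          have hne : min (t : WithTop ℝ≥0) (σ₂ ω) ≠ ⊤ := ne_top_of_le_ne_top WithTop.coe_ne_top (min_le_left _ _)
          rw [← coe_untopA_of_ne_top' hne]; exact WithTop.coe_le_coe.2 hr2
        exact h1.trans (min_le_right _ _)
      rcases eq_or_lt_of_le hr1 with h | h
      · rw [← h]
        exact ((hXτ ω τ₀ hτ₀).2.trans haρ.le)
      · refine mem_of_forall_mem_Ico (hXcont ω) hKballc.isClosed h fun r' h1 h2 ↦ ?_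
        have hτr' : τ ω ≤ r' := by rw [hτ₀]; exact WithTop.coe_le_coe.2 h1
        have hlt' : (r' : WithTop ℝ≥0) < σ₂ ω := by rw [hσr]; exact WithTop.coe_lt_coe.2 h2
        have hnot : ¬ ρ ≤ N (x₀ + W r' ω) := notMem_of_lt_hittingFrom hτr' hlt'
        exact (not_le.1 hnot).le
  -- the two optional-stopping identities
  set V : (Fin 2 → ℝ) → ℝ := fun v ↦ Real.log ((v 0 - c.re) ^ 2 + (v 1 - c.im) ^ 2) / 2 with hVdef
  have hVN : ∀ v, V v = Real.log (N v) := fun v ↦ logDist_eq_log_norm v c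
  set U : Set (Fin 2 → ℝ) := {v | (v 0 - c.re) ^ 2 + (v 1 - c.im) ^ 2 ≠ 0} with hUdef
  have hUN : ∀ v, v ∈ U ↔ N v ≠ 0 := fun v ↦ by
    simp only [hUdef, mem_setOf_eq, hNdef, norm_toC_sub]
    rw [not_iff_not, Real.sqrt_eq_zero (by positivity)]
  have hKannU : Kann ⊆ U := fun v hv ↦ (hUN v).2 (lt_of_lt_of_le hr₁ hv.1).ne'
  have hΔV : ∀ y ∈ U, lap V y = 0 := fun y hy ↦ lap_logDist_eq_zero c.re c.im hy
  obtain ⟨hint1, hI1⟩ := hW.setIntegral_stopped_sub_of_confined (isOpen_sqDist_ne_zero c.re c.im)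
    (contDiffOn_logDist c.re c.im) hΔV hKannc hKannU hτ hσ hτσ hA t hconf1
  set Q : (Fin 2 → ℝ) → ℝ := fun v ↦ (v 0 - c.re) ^ 2 + (v 1 - c.im) ^ 2 with hQdef
  have hQN : ∀ v, Q v = N v ^ 2 := fun v ↦ by
    simp only [hQdef, hNdef, norm_toC_sub]
    rw [Real.sq_sqrt (by positivity)]
  have hΔQ : ∀ y ∈ (univ : Set (Fin 2 → ℝ)), lap Q y = 4 := fun y _ ↦ lap_sqDist c.re c.im y
  obtain ⟨hint2, hI2⟩ := hW.setIntegral_stopped_sub_of_confined isOpen_univ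
    (contDiff_sqDist c.re c.im).contDiffOn hΔQ hKballc (subset_univ _) hτ hσ₂ hτσ₂ hA t hconf2
  -- abbreviations for the stopped positions and clocks
  set Xσ : WienerPair → (Fin 2 → ℝ) := fun ω ↦ x₀ + W (min (t : WithTop ℝ≥0) (σ ω)).untopA ω with hXσ
  set Xσ₂ : WienerPair → (Fin 2 → ℝ) := fun ω ↦ x₀ + W (min (t : WithTop ℝ≥0) (σ₂ ω)).untopA ω with hXσ₂
  set Xτ : WienerPair → (Fin 2 → ℝ) := fun ω ↦ x₀ + W (min (t : WithTop ℝ≥0) (τ ω)).untopA ω with hXτ'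
  have hmXσ : Measurable Xσ := hW.measurable_stoppedProcess_path x₀ hσ t
  have hmXσ₂ : Measurable Xσ₂ := hW.measurable_stoppedProcess_path x₀ hσ₂ t
  have hmXτ : Measurable Xτ := hW.measurable_stoppedProcess_path x₀ hτ t
  have hint1' : IntegrableOn (fun ω ↦ V (Xσ ω) - V (Xτ ω) - 0 / 2 *
      (((min (t : WithTop ℝ≥0) (σ ω)).untopA : ℝ) - (min (t : WithTop ℝ≥0) (τ ω)).untopA)) A wienerPair := hint1
  have hI1' : ∫ ω in A, (V (Xσ ω) - V (Xτ ω) - 0 / 2 *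
      (((min (t : WithTop ℝ≥0) (σ ω)).untopA : ℝ) - (min (t : WithTop ℝ≥0) (τ ω)).untopA)) ∂wienerPair = 0 := hI1
  have hint2' : IntegrableOn (fun ω ↦ Q (Xσ₂ ω) - Q (Xτ ω) - 4 / 2 *
      (((min (t : WithTop ℝ≥0) (σ₂ ω)).untopA : ℝ) - (min (t : WithTop ℝ≥0) (τ ω)).untopA)) A wienerPair := hint2
  have hI2' : ∫ ω in A, (Q (Xσ₂ ω) - Q (Xτ ω) - 4 / 2 *
      (((min (t : WithTop ℝ≥0) (σ₂ ω)).untopA : ℝ) - (min (t : WithTop ℝ≥0) (τ ω)).untopA)) ∂wienerPair = 0 := hI2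
  have hmN : Measurable N := hNcont.measurable
  have hmV : Measurable V := by
    simp only [hVdef]
    exact ((Real.measurable_log.comp (continuous_sqDist c.re c.im).measurable).div_const 2)
  -- values on `A`
  have hXτA : ∀ ω ∈ A, r₁ < N (Xτ ω) ∧ N (Xτ ω) ≤ a := by
    intro ω hω
    obtain ⟨τ₀, hτ₀⟩ := hAfin ω hω
    simp only [hXτ', hminτ ω hω τ₀ hτ₀]
    exact hXτ ω τ₀ hτ₀
  have hXσA : ∀ ω ∈ A, Xσ ω ∈ Kann := fun ω hω ↦
    hconf1 ω hω _ (untopA_min_coe_le_of_le t (hτσ ω)) le_rfl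
  have hXσ₂A : ∀ ω ∈ A, Xσ₂ ω ∈ Kball := fun ω hω ↦
    hconf2 ω hω _ (untopA_min_coe_le_of_le t (hτσ₂ ω)) le_rfl
  have hXτball : ∀ ω ∈ A, Xτ ω ∈ Kball := fun ω hω ↦
    hconf2 ω hω _ le_rfl (untopA_min_coe_le_of_le t (hτσ₂ ω))
  ----------------------------------------------------------------
  -- Step 1: the `log` bound.  `f₁ = log N(X_{t∧σ}) − log r₁`
  ----------------------------------------------------------------
  set f₁ : WienerPair → ℝ := fun ω ↦ V (Xσ ω) - Real.log r₁ with hf₁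
  have hmf₁ : Measurable f₁ := (hmV.comp hmXσ).sub measurable_const
  have hf₁nn : ∀ ω ∈ A, 0 ≤ f₁ ω := fun ω hω ↦ by
    simp only [hf₁, hVN]
    exact sub_nonneg.2 (Real.log_le_log hr₁ (hXσA ω hω).1)
  have hf₁bd : ∀ ω ∈ A, f₁ ω ≤ Real.log ρ - Real.log r₁ := fun ω hω ↦ by
    simp only [hf₁, hVN]
    exact sub_le_sub_right (Real.log_le_log (hr₁.trans_le (hXσA ω hω).1) (hXσA ω hω).2) _
  -- the `τ`-term: `g₁ = log N(X_τ) − log r₁ ∈ [0, log a − log r₁]` on `A`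
  set g₁ : WienerPair → ℝ := fun ω ↦ V (Xτ ω) - Real.log r₁ with hg₁
  have hmg₁ : Measurable g₁ := (hmV.comp hmXτ).sub measurable_const
  have hg₁bd : ∀ ω ∈ A, 0 ≤ g₁ ω ∧ g₁ ω ≤ Real.log a - Real.log r₁ := fun ω hω ↦ by
    simp only [hg₁, hVN]
    exact ⟨sub_nonneg.2 (Real.log_le_log hr₁ (hXτA ω hω).1.le),
      sub_le_sub_right (Real.log_le_log (hr₁.trans (hXτA ω hω).1) (hXτA ω hω).2) _⟩
  have hg₁int : IntegrableOn g₁ A wienerPair := by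
    refine Measure.integrableOn_of_bounded (M := Real.log a - Real.log r₁) (measure_ne_top _ _)
      hmg₁.aestronglyMeasurable ?_
    refine (ae_restrict_iff' hAm).2 (ae_of_all _ fun ω hω ↦ ?_)
    rw [Real.norm_eq_abs, abs_of_nonneg (hg₁bd ω hω).1]
    exact (hg₁bd ω hω).2
  -- `f₁ = (identity integrand) + g₁` on `A`
  have hf₁eq : ∀ ω ∈ A, f₁ ω = (V (Xσ ω) - V (Xτ ω) - 0 / 2 * (((min (t : WithTop ℝ≥0) (σ ω)).untopA : ℝ) -
      (min (t : WithTop ℝ≥0) (τ ω)).untopA)) + g₁ ω := fun ω _ ↦ by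
    simp only [hf₁, hg₁]; ring
  have hf₁int : IntegrableOn f₁ A wienerPair :=
    (hint1'.add hg₁int).congr_fun (fun ω hω ↦ (hf₁eq ω hω).symm) hAm
  have hIf₁ : ∫ ω in A, f₁ ω ∂wienerPair ≤ (Real.log a - Real.log r₁) * wienerPair.real A := by
    rw [setIntegral_congr_fun hAm hf₁eq, integral_add hint1' hg₁int, hI1', zero_add]
    calc ∫ ω in A, g₁ ω ∂wienerPair ≤ ∫ _ in A, (Real.log a - Real.log r₁) ∂wienerPair := by
          refine setIntegral_mono_on hg₁int (integrableOn_const (measure_ne_top _ _)) hAm fun ω hω ↦ (hg₁bd ω hω).2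
      _ = (Real.log a - Real.log r₁) * wienerPair.real A := by
          rw [setIntegral_const, smul_eq_mul, mul_comm]
  -- Markov on `P|_A`
  have hlogρr : 0 < Real.log ρ - Real.log r₁ := sub_pos.2 (Real.log_lt_log hr₁ (hra.trans haρ))
  have hmk1 := mul_meas_ge_le_integral_of_nonneg (μ := wienerPair.restrict A)
    ((ae_restrict_iff' hAm).2 (ae_of_all _ hf₁nn)) hf₁int (Real.log ρ - Real.log r₁)
  have hP1 : wienerPair (A ∩ {ω | Real.log ρ - Real.log r₁ ≤ f₁ ω}) ≤
      ENNReal.ofReal ((Real.log a - Real.log r₁) / (Real.log ρ - Real.log r₁)) * wienerPair A := by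
    calc wienerPair (A ∩ {ω | Real.log ρ - Real.log r₁ ≤ f₁ ω})
        = wienerPair ({ω | Real.log ρ - Real.log r₁ ≤ f₁ ω} ∩ A) := by rw [inter_comm]
      _ ≤ wienerPair.restrict A {ω | Real.log ρ - Real.log r₁ ≤ f₁ ω} := Measure.le_restrict_apply _ _
      _ = ENNReal.ofReal ((wienerPair.restrict A).real {ω | Real.log ρ - Real.log r₁ ≤ f₁ ω}) := by
          rw [measureReal_def, ENNReal.ofReal_toReal (measure_ne_top _ _)]
      _ ≤ ENNReal.ofReal ((Real.log a - Real.log r₁) / (Real.log ρ - Real.log r₁) * wienerPair.real A) := by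
          refine ENNReal.ofReal_le_ofReal ?_
          rw [div_mul_eq_mul_div, le_div_iff₀ hlogρr, mul_comm]
          exact hmk1.trans hIf₁
      _ = ENNReal.ofReal ((Real.log a - Real.log r₁) / (Real.log ρ - Real.log r₁)) * wienerPair A := by
          rw [ENNReal.ofReal_mul (div_nonneg (sub_nonneg.2 (Real.log_le_log hr₁ hra.le)) hlogρr.le),
            measureReal_def, ENNReal.ofReal_toReal (measure_ne_top _ _)]
  ----------------------------------------------------------------
  -- Step 2: the time bound.  `f₂ = (t∧σ₂) − (t∧τ)`
  ----------------------------------------------------------------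
  set f₂ : WienerPair → ℝ := fun ω ↦ ((min (t : WithTop ℝ≥0) (σ₂ ω)).untopA : ℝ) -
    (min (t : WithTop ℝ≥0) (τ ω)).untopA with hf₂
  have hmf₂ : Measurable f₂ :=
    (measurable_coe_nnreal_real.comp (hW.measurable_untopA_min hσ₂ t)).sub
      (measurable_coe_nnreal_real.comp (hW.measurable_untopA_min hτ t))
  have hf₂nn : ∀ ω, 0 ≤ f₂ ω := fun ω ↦
    sub_nonneg.2 (NNReal.coe_le_coe.2 (untopA_min_coe_le_of_le t (hτσ₂ ω)))
  have hf₂le : ∀ ω, f₂ ω ≤ t := fun ω ↦ by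
    simp only [hf₂]
    have h1 : ((min (t : WithTop ℝ≥0) (σ₂ ω)).untopA : ℝ) ≤ t := NNReal.coe_le_coe.2 (untopA_min_coe_le t _)
    have h2 : (0 : ℝ) ≤ (min (t : WithTop ℝ≥0) (τ ω)).untopA := NNReal.coe_nonneg _
    linarith
  have hf₂int : IntegrableOn f₂ A wienerPair := by
    refine Measure.integrableOn_of_bounded (M := t) (measure_ne_top _ _) hmf₂.aestronglyMeasurable ?_
    exact ae_of_all _ fun ω ↦ by rw [Real.norm_eq_abs, abs_of_nonneg (hf₂nn ω)]; exact hf₂le ω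
  -- the `Q`-terms on `A`
  set qσ : WienerPair → ℝ := fun ω ↦ Q (Xσ₂ ω) with hqσ
  set qτ : WienerPair → ℝ := fun ω ↦ Q (Xτ ω) with hqτ
  have hmQ : Measurable Q := (continuous_sqDist c.re c.im).measurable
  have hqσbd : ∀ ω ∈ A, 0 ≤ qσ ω ∧ qσ ω ≤ ρ ^ 2 := fun ω hω ↦ by
    simp only [hqσ, hQN]
    exact ⟨sq_nonneg _, pow_le_pow_left₀ (norm_nonneg _) (hXσ₂A ω hω) 2⟩
  have hqτbd : ∀ ω ∈ A, 0 ≤ qτ ω ∧ qτ ω ≤ ρ ^ 2 := fun ω hω ↦ by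
    simp only [hqτ, hQN]
    exact ⟨sq_nonneg _, pow_le_pow_left₀ (norm_nonneg _) (hXτball ω hω) 2⟩
  have hqσint : IntegrableOn qσ A wienerPair := by
    refine Measure.integrableOn_of_bounded (M := ρ ^ 2) (measure_ne_top _ _)
      (hmQ.comp hmXσ₂).aestronglyMeasurable ?_
    refine (ae_restrict_iff' hAm).2 (ae_of_all _ fun ω hω ↦ ?_)
    rw [Real.norm_eq_abs, abs_of_nonneg (hqσbd ω hω).1]; exact (hqσbd ω hω).2
  have hqτint : IntegrableOn qτ A wienerPair := by
    refine Measure.integrableOn_of_bounded (M := ρ ^ 2) (measure_ne_top _ _)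
      (hmQ.comp hmXτ).aestronglyMeasurable ?_
    refine (ae_restrict_iff' hAm).2 (ae_of_all _ fun ω hω ↦ ?_)
    rw [Real.norm_eq_abs, abs_of_nonneg (hqτbd ω hω).1]; exact (hqτbd ω hω).2
  -- `2 f₂ = qσ − qτ − (identity integrand)` on `A`
  have hf₂eq : ∀ ω ∈ A, (2 : ℝ) * f₂ ω = qσ ω - qτ ω - (Q (Xσ₂ ω) - Q (Xτ ω) -
      4 / 2 * (((min (t : WithTop ℝ≥0) (σ₂ ω)).untopA : ℝ) - (min (t : WithTop ℝ≥0) (τ ω)).untopA)) := by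
    intro ω _; simp only [hf₂, hqσ, hqτ]; ring
  have hIf₂ : ∫ ω in A, f₂ ω ∂wienerPair ≤ ρ ^ 2 / 2 * wienerPair.real A := by
    have h2f : ∫ ω in A, (2 : ℝ) * f₂ ω ∂wienerPair ≤ ρ ^ 2 * wienerPair.real A := by
      have h12 : IntegrableOn (fun ω ↦ qσ ω - qτ ω) A wienerPair := hqσint.sub hqτint
      rw [setIntegral_congr_fun hAm hf₂eq, integral_sub h12 hint2', hI2', sub_zero,
        integral_sub hqσint hqτint]
      have h1 : ∫ ω in A, qσ ω ∂wienerPair ≤ ρ ^ 2 * wienerPair.real A := by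
        calc ∫ ω in A, qσ ω ∂wienerPair ≤ ∫ _ in A, ρ ^ 2 ∂wienerPair :=
              setIntegral_mono_on hqσint (integrableOn_const (measure_ne_top _ _)) hAm fun ω hω ↦ (hqσbd ω hω).2
          _ = ρ ^ 2 * wienerPair.real A := by rw [setIntegral_const, smul_eq_mul, mul_comm]
      have h2 : 0 ≤ ∫ ω in A, qτ ω ∂wienerPair :=
        setIntegral_nonneg hAm fun ω hω ↦ (hqτbd ω hω).1
      linarith
    rw [integral_const_mul] at h2f
    linarith
  have hmk2 := mul_meas_ge_le_integral_of_nonneg (μ := wienerPair.restrict A)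
    (ae_of_all _ fun ω ↦ hf₂nn ω) hf₂int θ
  have hP2 : wienerPair (A ∩ {ω | (θ : ℝ) ≤ f₂ ω}) ≤ ENNReal.ofReal (ρ ^ 2 / (2 * θ)) * wienerPair A := by
    have hθ' : (0 : ℝ) < θ := hθ
    calc wienerPair (A ∩ {ω | (θ : ℝ) ≤ f₂ ω})
        = wienerPair ({ω | (θ : ℝ) ≤ f₂ ω} ∩ A) := by rw [inter_comm]
      _ ≤ wienerPair.restrict A {ω | (θ : ℝ) ≤ f₂ ω} := Measure.le_restrict_apply _ _
      _ = ENNReal.ofReal ((wienerPair.restrict A).real {ω | (θ : ℝ) ≤ f₂ ω}) := by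
          rw [measureReal_def, ENNReal.ofReal_toReal (measure_ne_top _ _)]
      _ ≤ ENNReal.ofReal (ρ ^ 2 / (2 * θ) * wienerPair.real A) := by
          refine ENNReal.ofReal_le_ofReal ?_
          rw [show ρ ^ 2 / (2 * (θ : ℝ)) * wienerPair.real A = (ρ ^ 2 / 2 * wienerPair.real A) / θ by
            field_simp, le_div_iff₀ hθ', mul_comm]
          exact hmk2.trans hIf₂
      _ = ENNReal.ofReal (ρ ^ 2 / (2 * θ)) * wienerPair A := by
          rw [ENNReal.ofReal_mul (by positivity), measureReal_def, ENNReal.ofReal_toReal (measure_ne_top _ _)]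
  ----------------------------------------------------------------
  -- Step 3: the event is covered by the two Markov events
  ----------------------------------------------------------------
  have hcover : {ω | (∃ s ≤ t₁, w + planarBrownian s ω ∈ closedBall c a) ∧
      ∀ s ≤ T, w + planarBrownian s ω ∉ closedBall c r₁} ⊆
      (A ∩ {ω | Real.log ρ - Real.log r₁ ≤ f₁ ω}) ∪ (A ∩ {ω | (θ : ℝ) ≤ f₂ ω}) := by
    rintro ω ⟨hhit, havoid⟩
    have hωA : ω ∈ A := by rw [hAeq]; exact hhit
    obtain ⟨τ₀, hτ₀⟩ := hAfin ω hωA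
    have hτ₀t₁ : τ₀ ≤ t₁ := by
      have : (τ₀ : WithTop ℝ≥0) ≤ t₁ := by rw [← hτ₀]; exact hωA
      exact WithTop.coe_le_coe.1 this
    have havoidN : ∀ s ≤ T, ¬ N (x₀ + W s ω) ≤ r₁ := fun s hs h ↦
      havoid s hs (by rw [hNX] at h; simpa [mem_closedBall, dist_eq_norm] using h)
    by_cases hσle : σ ω ≤ ((τ₀ + θ : ℝ≥0) : WithTop ℝ≥0)
    · -- the annulus is left during the window, through the outer circle
      left
      refine ⟨hωA, ?_⟩
      obtain ⟨σ₀, hσ₀⟩ := WithTop.ne_top_iff_exists.1 (ne_top_of_le_ne_top WithTop.coe_ne_top hσle)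
      have hσ₀le : σ₀ ≤ τ₀ + θ := by rw [← hσ₀] at hσle; exact WithTop.coe_le_coe.1 hσle
      have hσ₀t : σ₀ ≤ t := hσ₀le.trans (add_le_add hτ₀t₁ le_rfl)
      have hσ₀T : σ₀ ≤ T := (hσ₀le.trans (add_le_add hτ₀t₁ le_rfl)).trans hT
      have hmem : x₀ + W σ₀ ω ∈ Fo := mem_of_hittingFrom_eq_coe hFoc (hXcont ω) hσ₀.symm
      have hout : ρ ≤ N (x₀ + W σ₀ ω) := hmem.resolve_left (havoidN σ₀ hσ₀T)
      have hXσeq : Xσ ω = x₀ + W σ₀ ω := by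
        simp only [hXσ, ← hσ₀, untopA_min_coe_coe, min_eq_right hσ₀t]
      show Real.log ρ - Real.log r₁ ≤ f₁ ω
      simp only [hf₁, hVN, hXσeq]
      exact sub_le_sub_right (Real.log_le_log hρ hout) _
    · -- the path stays in the ball during the whole window
      right
      refine ⟨hωA, ?_⟩
      have hlt : ((τ₀ + θ : ℝ≥0) : WithTop ℝ≥0) < σ₂ ω := lt_of_lt_of_le (not_le.1 hσle) (hσσ₂ ω)
      have hge : τ₀ + θ ≤ (min (t : WithTop ℝ≥0) (σ₂ ω)).untopA := by
        have h1 : ((τ₀ + θ : ℝ≥0) : WithTop ℝ≥0) ≤ min (t : WithTop ℝ≥0) (σ₂ ω) :=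
          le_min (WithTop.coe_le_coe.2 (add_le_add hτ₀t₁ le_rfl)) hlt.le
        have hne : min (t : WithTop ℝ≥0) (σ₂ ω) ≠ ⊤ := ne_top_of_le_ne_top WithTop.coe_ne_top (min_le_left _ _)
        rw [← coe_untopA_of_ne_top' hne] at h1
        exact WithTop.coe_le_coe.1 h1
      show (θ : ℝ) ≤ f₂ ω
      simp only [hf₂, hminτ ω hωA τ₀ hτ₀]
      have : ((τ₀ + θ : ℝ≥0) : ℝ) ≤ (min (t : WithTop ℝ≥0) (σ₂ ω)).untopA := NNReal.coe_le_coe.2 hge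
      push_cast at this
      linarith
  -- conclusion
  calc wienerPair {ω | (∃ s ≤ t₁, w + planarBrownian s ω ∈ closedBall c a) ∧
        ∀ s ≤ T, w + planarBrownian s ω ∉ closedBall c r₁}
      ≤ wienerPair ((A ∩ {ω | Real.log ρ - Real.log r₁ ≤ f₁ ω}) ∪ (A ∩ {ω | (θ : ℝ) ≤ f₂ ω})) :=
        measure_mono hcover
    _ ≤ wienerPair (A ∩ {ω | Real.log ρ - Real.log r₁ ≤ f₁ ω}) + wienerPair (A ∩ {ω | (θ : ℝ) ≤ f₂ ω}) :=
        measure_union_le _ _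
    _ ≤ ENNReal.ofReal ((Real.log a - Real.log r₁) / (Real.log ρ - Real.log r₁)) * wienerPair A +
          ENNReal.ofReal (ρ ^ 2 / (2 * θ)) * wienerPair A := add_le_add hP1 hP2
    _ = ENNReal.ofReal (Real.log (a / r₁) / Real.log (ρ / r₁) + ρ ^ 2 / (2 * θ)) *
          wienerPair {ω | ∃ s ≤ t₁, w + planarBrownian s ω ∈ closedBall c a} := by
        rw [← add_mul, ← ENNReal.ofReal_add (div_nonneg (sub_nonneg.2 (Real.log_le_log hr₁ hra.le)) hlogρr.le)
          (by positivity), Real.log_div ha.ne' hr₁.ne', Real.log_div hρ.ne' hr₁.ne', hAeq]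

end Literature.Probability.RandomPlanarGeometry

end
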